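import Mathlib
import Summits.NavierStokesRegularity.NavierStokesRegularity.Theorems.FilamentSkeletonRssDefectColumnGateAzimuthalBlockPrelim

/-!
# Route `FilamentSkeletonRss` · crux `TransverseReduction1AG` (stmt-NavierStokesRegularity-27853; A1L twin stmt-23297) · line
# `defect_column_gate_1AG/1AL` — the EXTERIOR estimate for the azimuthal blocks of the localised sectional waist gate `WaistColumnGateLoc1A`
# (stub S2a-loc), EVERY order `m`, arbitrary rotation profile: outside the sectional radius `r₁ = 8/√γ` the sup-weighted modulus of a mode is
# controlled by its value at `r₁` and by the forcing, uniformly in the localisation radius, the rotation profile and `m`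

Helper file (`--supports stmt-NavierStokesRegularity-27853 --as helper`; seat ns-filament-s2aloc-p1 g2, MINT req187 no-hit branch; brick (E) of the
three-zone scheme of the seat's note ARCHITECTURE-B2B3-s2aloc-g2.md, evidence #52 on 27853 / #13 on 23297).  Companion of
`Theorems/…AzimuthalBlock.lean` (`azimuthalBlock_apriori`: the GLOBAL bound for `m² ≥ 9`) and built on the same preliminaries
(`maxPrinciple_of_wronskian`, `Theorems/…AzimuthalBlockPrelim.lean`, p670849).

THE BLOCK (dictionary as in `…AzimuthalBlock.lean`).  In `u = r²`, for the vorticity coefficient `w = a + ib` of `e^{imθ}` of an axially constant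
horizontal perturbation of the SYMMETRIC column: `−(4u a′ + γu a)′ + (m²/u) a − V b = f₁`, `−(4u b′ + γu b)′ + (m²/u) b + V a = f₂`, `V : ℝ → ℝ`
arbitrary (frame rotation + differential rotation `Rc·Ω` of the column, any `Rc`, any sign; the Biot–Savart coupling may be put into `f`).

THE ESTIMATE (`azimuthalBlock_exterior`).  For ANY `m : ℝ` (also `m = 0, ±1, ±2`), any `u₁ ≥ 64/γ`, data `(1+u)²|f_i| ≤ M` on `(u₁, ∞)`, support
`a = b = 0` on `[U, ∞)`: for every `u ≥ u₁`,  `u⁴ (a² + b²)(u) ≤ max (16 M²/γ²) (u₁⁴ (a² + b²)(u₁))`.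
So beyond `u₁` nothing can grow: the weighted modulus is bounded by its inner boundary value and the forcing — with NO dependence on `U = R²`, on
`V` or on `m`.  This is the exterior zone of the seat's three-zone scheme (there `u₁ = Rc^θ`): it is blind to the rotation profile, which is why
the counter-rotating critical layer (`Rc Ω(u_c) = |ρ| ≤ Λ`, `u_c ≈ Rc/(2π|ρ|)`) costs nothing for the symmetric column.

THE MECHANISM.  As in the global lemma: the potential drops out of the modulus flux `(u e^{γu/4} s′)′ = (e^{γu/4}/2)[4u(a′²+b′²) + (m²/u − γ)s −
(a f₁ + b f₂)]`, and `ψ = u^{−4}` is a strict supersolution of the modulus operator wherever `γu ≥ 64` (symbol `m² + γu − 32 ≥ γu/2`), for every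
`m`; the first-order maximum principle `maxPrinciple_of_wronskian` is applied on `[u₁, U]` with threshold `max(16M²/γ², v(u₁))`, `v = s·u⁴`,
Wronskian flux `u(u s′ + 4s)`.  Only first derivatives of `a, b` and of the fluxes `4u a′ + γu a`, `4u b′ + γu b` are used.
HONEST FRAMING: elementary analysis about ONE family of blocks of ONE linear MODEL operator of a hypothetical blow-up route (MODEL rung, negative
side); `WaistColumnGateLoc1A`, `TransverseReduction1AG/1AL` are neither proved nor refuted here; nothing in this file bears on Navier–Stokes
regularity.
-/

set_option linter.dupNamespace false

noncomputable section

namespace Summit.NavierStokesRegularity.NavierStokesRegularity.Theorems.DefectColumnGate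

open scoped Topology
open Set Filter

set_option maxHeartbeats 1600000 in
/-- **Exterior estimate for the azimuthal blocks of S2a-loc (symmetric column, any order `m`, arbitrary rotation potential).**  Data in
`u = r²` on `[u₁, ∞)`, `u₁ ≥ 64/γ`: `a, b` continuous on `[u₁,∞)` with derivatives `a₁, b₁` on `(u₁,∞)`; the block
`(4u a₁ + γu a)′ = (m²/u) a − V b − f₁`, `(4u b₁ + γu b)′ = (m²/u) b + V a − f₂` on `(u₁,∞)` with ANY `V : ℝ → ℝ` and ANY `m : ℝ`; data
`(1+u)²|f₁|, (1+u)²|f₂| ≤ M` on `(u₁, ∞)`; support `a = b = 0` on `[U,∞)`.  Conclusion: for all `u ≥ u₁`,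
`u⁴ (a u² + b u²) ≤ max (16 M²/γ²) (u₁⁴ (a u₁² + b u₁²))`. -/
theorem azimuthalBlock_exterior {γ m u₁ U M : ℝ} {a a₁ b b₁ f₁ f₂ V : ℝ → ℝ} (hγ : 0 < γ) (hu₁ : 64 / γ ≤ u₁)
    (ha : ContinuousOn a (Ici u₁)) (hb : ContinuousOn b (Ici u₁))
    (hdera : ∀ u, u₁ < u → HasDerivAt a (a₁ u) u) (hderb : ∀ u, u₁ < u → HasDerivAt b (b₁ u) u)
    (hΦa : ∀ u, u₁ < u →
      HasDerivAt (fun s => 4 * s * a₁ s + γ * s * a s) (m ^ 2 / u * a u - V u * b u - f₁ u) u)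
    (hΦb : ∀ u, u₁ < u →
      HasDerivAt (fun s => 4 * s * b₁ s + γ * s * b s) (m ^ 2 / u * b u + V u * a u - f₂ u) u)
    (hf₁ : ∀ u, u₁ < u → (1 + u) ^ 2 * |f₁ u| ≤ M) (hf₂ : ∀ u, u₁ < u → (1 + u) ^ 2 * |f₂ u| ≤ M)
    (hsuppa : ∀ u, U ≤ u → a u = 0) (hsuppb : ∀ u, U ≤ u → b u = 0) :
    ∀ u, u₁ ≤ u → u ^ 4 * (a u ^ 2 + b u ^ 2) ≤ max (16 * M ^ 2 / γ ^ 2) (u₁ ^ 4 * (a u₁ ^ 2 + b u₁ ^ 2)) := by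
  have hγ0 : γ ≠ 0 := hγ.ne'
  have hu₁pos : 0 < u₁ := lt_of_lt_of_le (by positivity) hu₁
  have hγu₁ : 64 ≤ γ * u₁ := by
    have := mul_le_mul_of_nonneg_left hu₁ hγ.le
    rwa [mul_div_cancel₀ _ hγ0] at this
  -- the threshold
  set K₀ : ℝ := max (16 * M ^ 2 / γ ^ 2) (u₁ ^ 4 * (a u₁ ^ 2 + b u₁ ^ 2)) with hK₀def
  have hK₀1 : 16 * M ^ 2 / γ ^ 2 ≤ K₀ := le_max_left _ _
  have hK₀2 : u₁ ^ 4 * (a u₁ ^ 2 + b u₁ ^ 2) ≤ K₀ := le_max_right _ _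
  have hK₀ : 0 ≤ K₀ := le_trans (by positivity) hK₀1
  -- the players
  set S : ℝ → ℝ := fun t => a t ^ 2 + b t ^ 2 with hSdef
  set v : ℝ → ℝ := fun t => S t * t ^ 4 with hvdef
  set v₁ : ℝ → ℝ := fun t => (2 * a t * a₁ t + 2 * b t * b₁ t) * t ^ 4 + S t * (4 * t ^ 3) with hv₁def
  set Wr : ℝ → ℝ := fun t => t * ((a t * (4 * t * a₁ t + γ * t * a t) + b t * (4 * t * b₁ t + γ * t * b t)
      - γ * t * S t) / 2) + 4 * t * S t with hWrdef
  set P : ℝ → ℝ := fun t => t / t ^ 3 with hPdef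
  -- trivial case `U ≤ u₁`: everything vanishes on `[u₁, ∞)`
  intro u hu
  by_cases hUu₁ : U ≤ u₁
  · have h1 : a u = 0 := hsuppa u (le_trans hUu₁ hu)
    have h2 : b u = 0 := hsuppb u (le_trans hUu₁ hu)
    rw [h1, h2]; simpa using hK₀
  have hU : u₁ < U := lt_of_not_ge hUu₁
  -- §A: the maximum principle on `[u₁, U]` gives `v ≤ K₀`
  have hMP : ∀ u ∈ Icc u₁ U, v u ≤ K₀ := by
    refine maxPrinciple_of_wronskian (v := v) (v₁ := v₁) (Wr := Wr) (P := P) hU.le ?_ ?_ ?_ ?_ ?_ ?_ ?_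
    · -- continuity of `v` on `[u₁, U]`
      have hS : ContinuousOn S (Icc u₁ U) := by
        have ha' := ha.mono (show Icc u₁ U ⊆ Ici u₁ from fun t ht => ht.1)
        have hb' := hb.mono (show Icc u₁ U ⊆ Ici u₁ from fun t ht => ht.1)
        exact (ha'.pow 2).add (hb'.pow 2)
      exact hS.mul (continuousOn_id.pow 4)
    · -- derivative of `v`
      intro u hu
      have ha' := hdera u hu.1
      have hb' := hderb u hu.1
      have hS' : HasDerivAt S (2 * a u * a₁ u + 2 * b u * b₁ u) u := by
        have h1 : HasDerivAt (fun t => a t ^ 2) (2 * a u * a₁ u) u :=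
          (ha'.fun_pow 2).congr_deriv (by norm_num)
        have h2 : HasDerivAt (fun t => b t ^ 2) (2 * b u * b₁ u) u :=
          (hb'.fun_pow 2).congr_deriv (by norm_num)
        exact h1.add h2
      have hk : HasDerivAt (fun t : ℝ => t ^ 4) (4 * u ^ 3) u :=
        ((hasDerivAt_id' u).fun_pow 4).congr_deriv (by norm_num)
      exact hS'.mul hk
    · -- `Wr = P · v₁`
      intro u hu
      have hu0 : u ≠ 0 := (lt_trans hu₁pos hu.1).ne'
      simp only [hWrdef, hPdef, hv₁def, hSdef]
      field_simp
      ring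
    · -- `P > 0`
      intro u hu
      simp only [hPdef]
      have hu0 : 0 < u := lt_trans hu₁pos hu.1
      positivity
    · -- STRICT positivity of `Wr′` at critical points above the threshold
      intro u hu hvK hv₁0
      have hu0 : 0 < u := lt_trans hu₁pos hu.1
      have hu0' : u ≠ 0 := hu0.ne'
      have hγu : 64 ≤ γ * u := le_trans hγu₁ (mul_le_mul_of_nonneg_left hu.1.le hγ.le)
      have ha' := hdera u hu.1
      have hb' := hderb u hu.1
      have hA := hΦa u hu.1
      have hB := hΦb u hu.1
      -- derivative of `S`
      have hS' : HasDerivAt S (2 * a u * a₁ u + 2 * b u * b₁ u) u := by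
        have h1 : HasDerivAt (fun t => a t ^ 2) (2 * a u * a₁ u) u :=
          (ha'.fun_pow 2).congr_deriv (by norm_num)
        have h2 : HasDerivAt (fun t => b t ^ 2) (2 * b u * b₁ u) u :=
          (hb'.fun_pow 2).congr_deriv (by norm_num)
        exact h1.add h2
      -- derivative of the inner bracket `G`
      have hG : HasDerivAt (fun t => (a t * (4 * t * a₁ t + γ * t * a t) + b t * (4 * t * b₁ t + γ * t * b t)
          - γ * t * S t) / 2)
          ((a₁ u * (4 * u * a₁ u + γ * u * a u) + a u * (m ^ 2 / u * a u - V u * b u - f₁ u)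
            + (b₁ u * (4 * u * b₁ u + γ * u * b u) + b u * (m ^ 2 / u * b u + V u * a u - f₂ u))
            - (γ * S u + γ * u * (2 * a u * a₁ u + 2 * b u * b₁ u))) / 2) u := by
        have h1 := ha'.mul hA
        have h2 := hb'.mul hB
        have h3 : HasDerivAt (fun t => γ * t * S t) (γ * S u + γ * u * (2 * a u * a₁ u + 2 * b u * b₁ u)) u := by
          have hγt : HasDerivAt (fun t : ℝ => γ * t) γ u := by
            simpa using (hasDerivAt_id' u).const_mul γ
          exact hγt.mul hS'
        exact ((h1.add h2).sub h3).div_const 2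
      have h1κ : HasDerivAt (fun t : ℝ => t) 1 u := hasDerivAt_id' u
      have h4t : HasDerivAt (fun t : ℝ => 4 * t) 4 u := by simpa using (hasDerivAt_id' u).const_mul (4:ℝ)
      have hWrD := (h1κ.mul hG).add (h4t.mul hS')
      -- name the derivative
      set G : ℝ := (a u * (4 * u * a₁ u + γ * u * a u) + b u * (4 * u * b₁ u + γ * u * b u) - γ * u * S u) / 2 with hGdef
      set G' : ℝ := ((a₁ u * (4 * u * a₁ u + γ * u * a u) + a u * (m ^ 2 / u * a u - V u * b u - f₁ u)
            + (b₁ u * (4 * u * b₁ u + γ * u * b u) + b u * (m ^ 2 / u * b u + V u * a u - f₂ u))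
            - (γ * S u + γ * u * (2 * a u * a₁ u + 2 * b u * b₁ u))) / 2) with hG'def
      set D : ℝ := 1 * G + u * G' + (4 * S u + 4 * u * (2 * a u * a₁ u + 2 * b u * b₁ u)) with hDdef
      have hWrD' : HasDerivAt Wr D u := by
        have e : Wr = fun t => t * ((a t * (4 * t * a₁ t + γ * t * a t) + b t * (4 * t * b₁ t + γ * t * b t)
            - γ * t * S t) / 2) + 4 * t * S t := by
          funext t; simp only [hWrdef]
        rw [e]; exact hWrD
      refine ⟨D, ?_, hWrD'⟩
      -- `Wr u = 0` at the critical point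
      have hWr0 : Wr u = 0 := by
        have e1 : Wr u = P u * v₁ u := by
          simp only [hWrdef, hPdef, hv₁def, hSdef]
          field_simp
          ring
        rw [e1, hv₁0, mul_zero]
      have hWr0' : u * G + 4 * u * S u = 0 := by
        have : Wr u = u * G + 4 * u * S u := by simp only [hWrdef, hGdef]
        rw [← this]; exact hWr0
      -- the key algebraic identity for `D`
      have hDid : D = 2 * u * u * (a₁ u ^ 2 + b₁ u ^ 2) + S u * ((m ^ 2 + γ * u - 32) / 2)
          - u * (a u * f₁ u + b u * f₂ u) / 2
          + (5 - γ * u / 4) / u * (u * G + 4 * u * S u) := by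
        simp only [hDdef, hGdef, hG'def, hSdef]
        field_simp
        ring
      rw [hWr0', mul_zero, add_zero] at hDid
      -- lower bound of the symbol: `m² + γu − 32 ≥ γu/2`
      have hBr : γ * u / 4 ≤ (m ^ 2 + γ * u - 32) / 2 := by nlinarith [sq_nonneg m]
      have hS0 : 0 ≤ S u := by simp only [hSdef]; positivity
      have hM : 0 ≤ M := le_trans (by positivity) (hf₁ u hu.1)
      -- pointwise data bounds
      have hf₁' : |f₁ u| ≤ M / (1 + u) ^ 2 := by
        rw [le_div_iff₀ (by positivity)]; linarith [hf₁ u hu.1]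
      have hf₂' : |f₂ u| ≤ M / (1 + u) ^ 2 := by
        rw [le_div_iff₀ (by positivity)]; linarith [hf₂ u hu.1]
      -- from the threshold: `S u > 16 M² / (γ² (1+u)⁴)`
      have hSbig : 16 * M ^ 2 / (γ ^ 2 * (1 + u) ^ 4) < S u := by
        have hv' : K₀ < S u * u ^ 4 := by simpa [hvdef] using hvK
        have hcmp : u ^ 4 ≤ (1 + u) ^ 4 := pow_le_pow_left₀ hu0.le (by linarith) 4
        have h1 : 16 * M ^ 2 / γ ^ 2 < S u * (1 + u) ^ 4 :=
          calc 16 * M ^ 2 / γ ^ 2 ≤ K₀ := hK₀1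
            _ < S u * u ^ 4 := hv'
            _ ≤ S u * (1 + u) ^ 4 := mul_le_mul_of_nonneg_left hcmp hS0
        rw [div_lt_iff₀ (by positivity)]
        rw [div_lt_iff₀ (by positivity)] at h1
        nlinarith [h1]
      -- the data term is dominated
      set t : ℝ := 4 * M / (γ * (1 + u) ^ 2) with htdef
      have ht0 : 0 ≤ t := by positivity
      have ht2 : t ^ 2 = 16 * M ^ 2 / (γ ^ 2 * (1 + u) ^ 4) := by
        rw [htdef, div_pow]; congr 1 <;> ring
      have hSt : t ^ 2 < S u := by rw [ht2]; exact hSbig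
      have hSpos : 0 < S u := lt_of_le_of_lt (sq_nonneg t) hSt
      have hab : (|a u| + |b u|) ^ 2 ≤ 2 * S u := by
        simp only [hSdef]
        nlinarith [sq_nonneg (|a u| - |b u|), sq_abs (a u), sq_abs (b u)]
      have hdom : (|a u| + |b u|) * t < 2 * S u := by
        have hsq : ((|a u| + |b u|) * t) ^ 2 < (2 * S u) ^ 2 := by
          have : ((|a u| + |b u|) * t) ^ 2 = (|a u| + |b u|) ^ 2 * t ^ 2 := by ring
          rw [this]
          have h2 : (|a u| + |b u|) ^ 2 * t ^ 2 ≤ 2 * S u * t ^ 2 :=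
            mul_le_mul_of_nonneg_right hab (sq_nonneg t)
          have h3 : 2 * S u * t ^ 2 < 2 * S u * S u := by nlinarith
          nlinarith
        have h2S : 0 ≤ 2 * S u := by linarith
        exact lt_of_pow_lt_pow_left₀ 2 h2S hsq
      have hdata : u * (a u * f₁ u + b u * f₂ u) / 2 < S u * (γ * u / 4) := by
        have h1 : a u * f₁ u + b u * f₂ u ≤ (|a u| + |b u|) * (M / (1 + u) ^ 2) := by
          have e1 : a u * f₁ u ≤ |a u| * |f₁ u| := by
            rw [← abs_mul]; exact le_abs_self _
          have e2 : b u * f₂ u ≤ |b u| * |f₂ u| := by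
            rw [← abs_mul]; exact le_abs_self _
          have e3 : |a u| * |f₁ u| ≤ |a u| * (M / (1 + u) ^ 2) :=
            mul_le_mul_of_nonneg_left hf₁' (abs_nonneg _)
          have e4 : |b u| * |f₂ u| ≤ |b u| * (M / (1 + u) ^ 2) :=
            mul_le_mul_of_nonneg_left hf₂' (abs_nonneg _)
          linarith
        have h2 : (|a u| + |b u|) * (M / (1 + u) ^ 2) = (|a u| + |b u|) * t * (γ / 4) := by
          rw [htdef]; field_simp
        have h3 : (|a u| + |b u|) * t * (γ / 4) < 2 * S u * (γ / 4) :=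
          mul_lt_mul_of_pos_right hdom (by positivity)
        have h4 : u * (a u * f₁ u + b u * f₂ u) / 2 ≤ u * ((|a u| + |b u|) * t * (γ / 4)) / 2 := by
          have := mul_le_mul_of_nonneg_left (h1.trans_eq h2) hu0.le
          linarith
        have h5 : u * ((|a u| + |b u|) * t * (γ / 4)) / 2 < u * (2 * S u * (γ / 4)) / 2 := by
          have := mul_lt_mul_of_pos_left h3 hu0
          linarith
        have h6 : u * (2 * S u * (γ / 4)) / 2 = S u * (γ * u / 4) := by ring
        linarith
      -- conclusion
      have hder2 : 0 ≤ 2 * u * u * (a₁ u ^ 2 + b₁ u ^ 2) := by positivity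
      have hmain : S u * (γ * u / 4) ≤ S u * ((m ^ 2 + γ * u - 32) / 2) :=
        mul_le_mul_of_nonneg_left hBr hS0
      rw [hDid]
      linarith
    · -- `v u₁ ≤ K₀`
      simp only [hvdef, hSdef]
      linarith [hK₀2]
    · -- `v U ≤ K₀`
      simp only [hvdef, hSdef, hsuppa U le_rfl, hsuppb U le_rfl]
      simpa using hK₀
  -- §B: conclusion on `[u₁, ∞)`
  rcases le_or_gt u U with h | h
  · have := hMP u ⟨hu, h⟩
    simpa [hvdef, hSdef, mul_comm] using this
  · rw [hsuppa u h.le, hsuppb u h.le]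
    simpa using hK₀

end Summit.NavierStokesRegularity.NavierStokesRegularity.Theorems.DefectColumnGate

end
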